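import Literature.NumberTheory.LFunctions.RayClassExplicitFormula
import Literature.NumberTheory.LFunctions.RayClassLFunctionImprimitive
import Literature.NumberTheory.LFunctions.ThornerZamanWeight
import HarnessLib

/-!
# Imprimitive versus primitive von Mangoldt coefficients of a ray class character: the smoothed
# prime-power sums differ by `O(log x · log N𝔪)`

Topic `Literature/NumberTheory/LFunctions`, namespace `Literature.NumberTheory.LFunctions`.  Theorem-only file
(no definition, no named fact), the ray-class bookkeeping step of Thorner–Zaman's passage from a character
`χ mod H` of a congruence class group `mod 𝔮` to the primitive character `χ*` inducing it
([ThornerZaman2017, Lemma 9.3]: "`S̃_χ` equals `S_χ` up to a negligible contribution from prime ideal powers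
… and prime ideals dividing `𝔮`"; Lagarias–Odlyzko [LagariasOdlyzko1977, §5] for the same comparison of
`L(s,χ)` and `L(s,χ*)`).

For a modulus `𝔪 ≠ 0` of the number field `K`, a function `ψ` on the primes and its primitive data
`D : RayClassPrimitiveData 𝔪 ψ` (conductor `𝔣 ∣ 𝔪`, primitive `χ₀ mod 𝔣` agreeing with `ψ` off `𝔪`):
* `norm_rcCoef_sub_rcCoef_le` — the von Mangoldt coefficients `Λ_{χ₀}(n) = Σ_{N𝔫=n} χ₀(𝔫)Λ(𝔫)` (`mod 𝔣`) and
  `Λ^𝔪_ψ(n)` (`mod 𝔪`) differ by at most `Σ_{N𝔫 = n, (𝔫,𝔪) ≠ 1} Λ(𝔫)`; the same for the trivial character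
  (`norm_cgCoef_one_sub_rcCoef_le`: `Λ_K(n)` versus `Λ^𝔪_1(n)`);
* `sum_range_idealVonMangoldt_not_isCoprime_le` — `Σ_{N𝔫 < N, (𝔫,𝔪) ≠ 1} Λ(𝔫) ≤ (log N/log 2) · log N𝔪`
  (such `𝔫` with `Λ(𝔫) ≠ 0` are the `𝔭^m`, `𝔭 ∣ 𝔪`, `2^m ≤ N𝔭^m < N`);
* `norm_coefFordK_sub_le_of_tzTest` and its two instances — for the Thorner–Zaman weight `g = tzTest L ε`
  (`0 ≤ g ≤ 1`, `g = 0` on `[L + ε, ∞)`, `0 < ε ≤ 1`):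
  `‖K_{g,Λ^𝔪_ψ}(0) − K_{g,Λ_{χ₀}}(0)‖ ≤ 2(L + 2) log N𝔪` (`K_{g,a}(0) = Σ_n a(n) g(log n)` is the tree's
  `coefFordK a g 0`).

## References
* [ThornerZaman2017] J. Thorner, A. Zaman, Algebra Number Theory 11 (2017), Lemma 9.3 and §3 (the modulus `𝔪`).
* [LagariasOdlyzko1977] J. C. Lagarias, A. M. Odlyzko, in *Algebraic Number Fields* (1977), §5.
-/

noncomputable section

open Complex Real Finset NumberField IsDedekindDomain UniqueFactorizationMonoid
open scoped NumberField nonZeroDivisors Classical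

namespace Literature.NumberTheory.LFunctions

open Literature.NumberTheory.LFunctions.NumberField Literature.NumberTheory.LFunctions.TZWeight

variable {K : Type} [Field K] [NumberField K]
variable {𝔪 : Ideal (𝓞 K)}

/-! ### The von Mangoldt weight of the ideals not prime to `𝔪` -/

/-- A nonzero ideal not prime to `𝔪 ≠ 0` with `Λ(𝔫) ≠ 0` is `𝔭^m` with `𝔭 ∣ 𝔪` and `2^m ≤ N𝔫`; hence, for
`N𝔫 < N`, `Λ(𝔫) ≤ Σ_{𝔭 ∣ 𝔪} Σ_{1 ≤ m ≤ log N/log 2} [𝔫 = 𝔭^m] log N𝔭`. [cite: ThornerZaman2017, Lemma 9.3] -/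
theorem idealVonMangoldt_le_sum_indicator (h𝔪 : 𝔪 ≠ ⊥) {I : Ideal (𝓞 K)} (hI : ¬ IsCoprime I 𝔪) {N : ℕ}
    (hN : Ideal.absNorm I < N) :
    idealVonMangoldt I ≤ ∑ v ∈ (Ideal.finite_factors h𝔪).toFinset,
      ∑ m ∈ Finset.Icc 1 ⌊Real.log N / Real.log 2⌋₊,
        if v.asIdeal ^ m = I then Real.log (Ideal.absNorm v.asIdeal) else 0 := by
  have hnn : 0 ≤ ∑ v ∈ (Ideal.finite_factors h𝔪).toFinset,
      ∑ m ∈ Finset.Icc 1 ⌊Real.log N / Real.log 2⌋₊,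
        if v.asIdeal ^ m = I then Real.log (Ideal.absNorm v.asIdeal) else 0 :=
    sum_nonneg fun v _ ↦ sum_nonneg fun m _ ↦ by
      split_ifs
      · exact Real.log_natCast_nonneg _
      · exact le_rfl
  by_cases hcard : (normalizedFactors I).toFinset.card = 1
  · obtain ⟨P, hP, -, -, hmpos, hIeq⟩ := eq_prime_pow_of_card_eq_one hcard
    set m := Multiset.card (normalizedFactors I) with hm
    have hP0 : P ≠ ⊥ := hP.ne_zero
    have hPprime : P.IsPrime := Ideal.isPrime_of_prime hP
    set v₀ : HeightOneSpectrum (𝓞 K) := ⟨P, hPprime, hP0⟩ with hv₀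
    have hΛ : idealVonMangoldt I = Real.log (Ideal.absNorm P) := by
      rw [hIeq]; exact idealVonMangoldt_prime_pow hP hmpos.ne'
    -- `P ∣ 𝔪`
    have hv₀mem : v₀ ∈ (Ideal.finite_factors h𝔪).toFinset := by
      rw [Set.Finite.mem_toFinset, Set.mem_setOf_eq]
      rw [isCoprime_iff_forall_not_le h𝔪] at hI
      push Not at hI
      obtain ⟨v, hmv, hIv⟩ := hI
      have hPv : P ≤ v.asIdeal := by
        rw [hIeq] at hIv
        exact Ideal.IsPrime.le_of_pow_le (hP := v.isPrime) hIv
      have hPeq : P = v.asIdeal :=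
        (Ideal.IsPrime.isMaximal hPprime hP0).eq_of_le v.isPrime.ne_top hPv
      change P ∣ 𝔪
      rw [Ideal.dvd_iff_le, hPeq]; exact hmv
    -- `m ≤ log N / log 2`
    have h2 : (2 : ℝ) ≤ (Ideal.absNorm P : ℝ) := by
      exact_mod_cast AbelianDensity.two_le_absNorm K v₀
    have hmM : m ∈ Finset.Icc 1 ⌊Real.log N / Real.log 2⌋₊ := by
      rw [Finset.mem_Icc]
      refine ⟨hmpos, Nat.le_floor ?_⟩
      have hNI : Ideal.absNorm I = Ideal.absNorm P ^ m := by rw [hIeq, map_pow]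
      have hpow : (2 : ℝ) ^ m ≤ (Ideal.absNorm I : ℝ) := by
        rw [hNI, Nat.cast_pow]; exact pow_le_pow_left₀ (by norm_num) h2 m
      have hlt : (2 : ℝ) ^ m < N := lt_of_le_of_lt hpow (by exact_mod_cast hN)
      have hN0 : (0 : ℝ) < N := lt_of_le_of_lt (by positivity) hlt
      have hlog := Real.log_lt_log (by positivity) hlt
      rw [Real.log_pow] at hlog
      have hl2 := (Real.log_pos one_lt_two)
      rw [le_div_iff₀ hl2]; exact hlog.le
    rw [hΛ]
    refine le_trans ?_ (Finset.single_le_sum (f := fun v ↦ ∑ m ∈ Finset.Icc 1 ⌊Real.log N / Real.log 2⌋₊,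
      if v.asIdeal ^ m = I then Real.log (Ideal.absNorm v.asIdeal) else 0)
      (fun v _ ↦ sum_nonneg fun m _ ↦ by
        split_ifs
        · exact Real.log_natCast_nonneg _
        · exact le_rfl) hv₀mem)
    refine le_trans ?_ (Finset.single_le_sum
      (f := fun m ↦ if v₀.asIdeal ^ m = I then Real.log (Ideal.absNorm v₀.asIdeal) else 0)
      (fun m _ ↦ by
        split_ifs
        · exact Real.log_natCast_nonneg _
        · exact le_rfl) hmM)
    simp only [hv₀]
    rw [if_pos hIeq.symm]
  · rw [idealVonMangoldt_eq_zero hcard]; exact hnn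

/-- `Σ_{𝔭 ∣ 𝔪} log N𝔭 ≤ log N𝔪` over the prime divisors of `𝔪 ≠ 0`. [cite: ThornerZaman2017, Lemma 9.3] -/
theorem sum_log_absNorm_primeFactors_le (h𝔪 : 𝔪 ≠ ⊥) :
    ∑ v ∈ (Ideal.finite_factors h𝔪).toFinset, Real.log (Ideal.absNorm v.asIdeal) ≤
      Real.log (Ideal.absNorm 𝔪 : ℕ) := by
  set T := (Ideal.finite_factors h𝔪).toFinset with hT
  have hTd : ∀ v ∈ T, v.asIdeal ∣ 𝔪 := fun v hv ↦ by
    rw [hT, Set.Finite.mem_toFinset] at hv; exact hv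
  have hinf : (T.inf fun v ↦ v.asIdeal) = ∏ v ∈ T, v.asIdeal := by
    have h := IsDedekindDomain.inf_pow_eq_prod_of_prime T (fun v : HeightOneSpectrum (𝓞 K) ↦ v.asIdeal)
      (fun _ ↦ 1) (fun v _ ↦ v.prime) (fun v _ w _ hvw h ↦ hvw (HeightOneSpectrum.ext h))
    simpa only [pow_one] using h
  have hdvd : (∏ v ∈ T, v.asIdeal) ∣ 𝔪 := by
    rw [← hinf, Ideal.dvd_iff_le, Finset.le_inf_iff]
    exact fun v hv ↦ Ideal.le_of_dvd (hTd v hv)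
  have hN : Ideal.absNorm (∏ v ∈ T, v.asIdeal) ∣ Ideal.absNorm 𝔪 := map_dvd Ideal.absNorm hdvd
  have hm0 : Ideal.absNorm 𝔪 ≠ 0 := by rwa [Ne, Ideal.absNorm_eq_zero_iff]
  have hle : Ideal.absNorm (∏ v ∈ T, v.asIdeal) ≤ Ideal.absNorm 𝔪 := Nat.le_of_dvd (Nat.pos_of_ne_zero hm0) hN
  rw [map_prod] at hle
  have hle' : ∏ v ∈ T, ((Ideal.absNorm v.asIdeal : ℕ) : ℝ) ≤ (Ideal.absNorm 𝔪 : ℕ) := by exact_mod_cast hle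
  have hpos : ∀ v ∈ T, (0 : ℝ) < (Ideal.absNorm v.asIdeal : ℕ) := fun v _ ↦ by
    exact_mod_cast Nat.pos_of_ne_zero (by rw [Ne, Ideal.absNorm_eq_zero_iff]; exact v.ne_bot)
  rw [← Real.log_prod (fun v hv ↦ (hpos v hv).ne')]
  exact Real.log_le_log (Finset.prod_pos hpos) hle'

/-- **`Σ_{N𝔫 < N, (𝔫,𝔪) ≠ 1} Λ(𝔫) ≤ (log N/log 2) · log N𝔪`** for `𝔪 ≠ 0`: the ideals not prime to `𝔪`
carry von Mangoldt weight only at the powers `𝔭^m`, `𝔭 ∣ 𝔪`, `m ≤ log N/log 2`. [cite: ThornerZaman2017, Lemma 9.3] -/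
theorem sum_range_idealVonMangoldt_not_isCoprime_le (h𝔪 : 𝔪 ≠ ⊥) (N : ℕ) :
    ∑ n ∈ Finset.range N, ∑ I ∈ (idealsOfNorm K n).filter (fun I ↦ ¬ IsCoprime I 𝔪), idealVonMangoldt I ≤
      Real.log N / Real.log 2 * Real.log (Ideal.absNorm 𝔪 : ℕ) := by
  set F := (Ideal.finite_factors h𝔪).toFinset with hF
  set M : ℕ := ⌊Real.log N / Real.log 2⌋₊ with hM
  set c : HeightOneSpectrum (𝓞 K) → ℝ := fun v ↦ Real.log (Ideal.absNorm v.asIdeal) with hc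
  have hc0 : ∀ v, 0 ≤ c v := fun v ↦ Real.log_natCast_nonneg _
  set h : Ideal (𝓞 K) → HeightOneSpectrum (𝓞 K) → ℕ → ℝ :=
    fun I v m ↦ if v.asIdeal ^ m = I then c v else 0 with hh
  have hh0 : ∀ I v m, 0 ≤ h I v m := fun I v m ↦ by
    simp only [hh]; split_ifs
    · exact hc0 v
    · exact le_rfl
  -- step 1: termwise
  have h1 : ∑ n ∈ Finset.range N, ∑ I ∈ (idealsOfNorm K n).filter (fun I ↦ ¬ IsCoprime I 𝔪), idealVonMangoldt I ≤
      ∑ n ∈ Finset.range N, ∑ I ∈ (idealsOfNorm K n).filter (fun I ↦ ¬ IsCoprime I 𝔪),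
        ∑ v ∈ F, ∑ m ∈ Finset.Icc 1 M, h I v m := by
    refine sum_le_sum fun n hn ↦ sum_le_sum fun I hI ↦ ?_
    rw [mem_filter, mem_idealsOfNorm] at hI
    rw [mem_range] at hn
    have := idealVonMangoldt_le_sum_indicator h𝔪 hI.2 (N := N) (by rw [hI.1]; exact hn)
    simpa only [hh, hF, hM, hc] using this
  -- step 2: swap
  have h2 : ∑ n ∈ Finset.range N, ∑ I ∈ (idealsOfNorm K n).filter (fun I ↦ ¬ IsCoprime I 𝔪),
        ∑ v ∈ F, ∑ m ∈ Finset.Icc 1 M, h I v m =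
      ∑ v ∈ F, ∑ m ∈ Finset.Icc 1 M, ∑ n ∈ Finset.range N,
        ∑ I ∈ (idealsOfNorm K n).filter (fun I ↦ ¬ IsCoprime I 𝔪), h I v m := by
    calc _ = ∑ n ∈ Finset.range N, ∑ v ∈ F, ∑ I ∈ (idealsOfNorm K n).filter (fun I ↦ ¬ IsCoprime I 𝔪),
          ∑ m ∈ Finset.Icc 1 M, h I v m := sum_congr rfl fun n _ ↦ Finset.sum_comm
      _ = ∑ v ∈ F, ∑ n ∈ Finset.range N, ∑ I ∈ (idealsOfNorm K n).filter (fun I ↦ ¬ IsCoprime I 𝔪),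
          ∑ m ∈ Finset.Icc 1 M, h I v m := Finset.sum_comm
      _ = ∑ v ∈ F, ∑ n ∈ Finset.range N, ∑ m ∈ Finset.Icc 1 M,
          ∑ I ∈ (idealsOfNorm K n).filter (fun I ↦ ¬ IsCoprime I 𝔪), h I v m :=
          sum_congr rfl fun v _ ↦ sum_congr rfl fun n _ ↦ Finset.sum_comm
      _ = _ := sum_congr rfl fun v _ ↦ Finset.sum_comm
  -- step 3: each `(v, m)` contributes at most `c v`
  have h3 : ∀ v m, ∑ n ∈ Finset.range N,
      ∑ I ∈ (idealsOfNorm K n).filter (fun I ↦ ¬ IsCoprime I 𝔪), h I v m ≤ c v := by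
    intro v m
    set J : Ideal (𝓞 K) := v.asIdeal ^ m with hJ
    have hin : ∀ n, ∑ I ∈ (idealsOfNorm K n).filter (fun I ↦ ¬ IsCoprime I 𝔪), h I v m ≤
        if Ideal.absNorm J = n then c v else 0 := by
      intro n
      have heq : ∑ I ∈ (idealsOfNorm K n).filter (fun I ↦ ¬ IsCoprime I 𝔪), h I v m =
          if J ∈ (idealsOfNorm K n).filter (fun I ↦ ¬ IsCoprime I 𝔪) then c v else 0 := by
        simp only [hh, ← hJ]
        rw [Finset.sum_ite_eq]
      rw [heq]
      by_cases hmem : J ∈ (idealsOfNorm K n).filter (fun I ↦ ¬ IsCoprime I 𝔪)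
      · rw [if_pos hmem]
        rw [mem_filter, mem_idealsOfNorm] at hmem
        rw [if_pos hmem.1]
      · rw [if_neg hmem]
        split_ifs
        · exact hc0 v
        · exact le_rfl
    calc ∑ n ∈ Finset.range N, ∑ I ∈ (idealsOfNorm K n).filter (fun I ↦ ¬ IsCoprime I 𝔪), h I v m
        ≤ ∑ n ∈ Finset.range N, (if Ideal.absNorm J = n then c v else 0) := sum_le_sum fun n _ ↦ hin n
      _ = if Ideal.absNorm J ∈ Finset.range N then c v else 0 := by rw [Finset.sum_ite_eq]
      _ ≤ c v := by
          split_ifs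
          · exact le_rfl
          · exact hc0 v
  -- step 4: assemble
  have hlog2 : 0 < Real.log 2 := Real.log_pos one_lt_two
  have hMle : (M : ℝ) ≤ Real.log N / Real.log 2 := by
    rw [hM]
    exact Nat.floor_le (div_nonneg (Real.log_natCast_nonneg _) hlog2.le)
  have hFsum : ∑ v ∈ F, c v ≤ Real.log (Ideal.absNorm 𝔪 : ℕ) := sum_log_absNorm_primeFactors_le h𝔪
  have hlogm : 0 ≤ Real.log (Ideal.absNorm 𝔪 : ℕ) := Real.log_natCast_nonneg _
  calc ∑ n ∈ Finset.range N, ∑ I ∈ (idealsOfNorm K n).filter (fun I ↦ ¬ IsCoprime I 𝔪), idealVonMangoldt I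
      ≤ ∑ v ∈ F, ∑ m ∈ Finset.Icc 1 M, ∑ n ∈ Finset.range N,
          ∑ I ∈ (idealsOfNorm K n).filter (fun I ↦ ¬ IsCoprime I 𝔪), h I v m := by rw [← h2]; exact h1
    _ ≤ ∑ v ∈ F, ∑ m ∈ Finset.Icc 1 M, c v := sum_le_sum fun v _ ↦ sum_le_sum fun m _ ↦ h3 v m
    _ = (M : ℝ) * ∑ v ∈ F, c v := by
        rw [Finset.mul_sum]
        refine sum_congr rfl fun v _ ↦ ?_
        rw [Finset.sum_const, Nat.card_Icc, nsmul_eq_mul]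
        simp
    _ ≤ Real.log N / Real.log 2 * Real.log (Ideal.absNorm 𝔪 : ℕ) :=
        mul_le_mul hMle hFsum (sum_nonneg fun v _ ↦ hc0 v) (div_nonneg (Real.log_natCast_nonneg _) hlog2.le)

/-! ### The coefficients of the imprimitive and the primitive `L`-function -/

omit [NumberField K] in
/-- `(𝔫, 𝔪) = 1` and `𝔣 ∣ 𝔪` imply `(𝔫, 𝔣) = 1`. [folklore] -/
private theorem isCoprime_of_isCoprime_of_le {I 𝔣 : Ideal (𝓞 K)} (h : IsCoprime I 𝔪) (hle : 𝔪 ≤ 𝔣) : IsCoprime I 𝔣 := by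
  rw [Ideal.isCoprime_iff_sup_eq] at h ⊢
  exact top_le_iff.1 (h ▸ sup_le_sup_left hle I)

namespace RayClassPrimitiveData

variable {ψ : HeightOneSpectrum (𝓞 K) → ℂ} (D : RayClassPrimitiveData 𝔪 ψ)

/-- **`|Λ_{χ₀}(n) − Λ^𝔪_ψ(n)| ≤ Σ_{N𝔫 = n, (𝔫,𝔪) ≠ 1} Λ(𝔫)`**: the von Mangoldt coefficients of the primitive
`L(s, χ₀)` (`mod 𝔣`) and of the imprimitive `L_𝔪(s, ψ)` agree on the ideals prime to `𝔪` (`χ₀ = ψ` off `𝔪`)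
and differ by at most `Λ(𝔫)` elsewhere. [cite: ThornerZaman2017, Lemma 9.3] -/
theorem norm_rcCoef_sub_rcCoef_le (n : ℕ) :
    ‖rcCoef D.𝔣 D.χ₀ n - rcCoef 𝔪 ψ n‖ ≤
      ∑ I ∈ (idealsOfNorm K n).filter (fun I ↦ ¬ IsCoprime I 𝔪), idealVonMangoldt I := by
  simp only [rcCoef, NumberField.twistVonMangoldt, rayClassCoeffHom_apply]
  rw [← Finset.sum_sub_distrib, Finset.sum_filter]
  refine (norm_sum_le _ _).trans (Finset.sum_le_sum fun I _ ↦ ?_)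
  rw [← sub_mul, norm_mul, Complex.norm_real, Real.norm_of_nonneg (idealVonMangoldt_nonneg I)]
  by_cases hcop : IsCoprime I 𝔪
  · -- the coefficients agree
    rw [if_neg (not_not.2 hcop)]
    have heq : rayClassCoeff D.𝔣 D.χ₀ I = rayClassCoeff 𝔪 ψ I := by
      unfold rayClassCoeff
      by_cases hI0 : I ≠ ⊥
      · rw [if_pos ⟨hI0, isCoprime_of_isCoprime_of_le hcop D.le⟩, if_pos ⟨hI0, hcop⟩]
        exact idealPow_congr_of_isCoprime D.modulus_ne_bot D.agree hI0 hcop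
      · rw [if_neg (fun h ↦ hI0 h.1), if_neg (fun h ↦ hI0 h.1)]
    rw [heq, sub_self, norm_zero, zero_mul]
  · rw [if_pos hcop]
    have hb : rayClassCoeff 𝔪 ψ I = 0 := by
      unfold rayClassCoeff; rw [if_neg (fun h ↦ hcop h.2)]
    rw [hb, sub_zero]
    exact mul_le_of_le_one_left (idealVonMangoldt_nonneg I) (norm_rayClassCoeff_le_one D.ne_bot D.norm_le_one I)

end RayClassPrimitiveData

/-- **`|Λ_K(n) − Λ^𝔪_1(n)| ≤ Σ_{N𝔫 = n, (𝔫,𝔪) ≠ 1} Λ(𝔫)`**: the coefficients of `−ζ_K'/ζ_K` (the tree's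
`cgCoef 1`) and of the trivial character `mod 𝔪` differ only on the ideals not prime to `𝔪`.
[cite: ThornerZaman2017, Lemma 9.3] -/
theorem norm_cgCoef_one_sub_rcCoef_le (𝔪 : Ideal (𝓞 K)) (n : ℕ) :
    ‖cgCoef (1 : ClassGroup (𝓞 K) →* ℂˣ) n - rcCoef 𝔪 (fun _ ↦ (1 : ℂ)) n‖ ≤
      ∑ I ∈ (idealsOfNorm K n).filter (fun I ↦ ¬ IsCoprime I 𝔪), idealVonMangoldt I := by
  simp only [cgCoef, rcCoef, NumberField.twistVonMangoldt, rayClassCoeffHom_apply]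
  rw [← Finset.sum_sub_distrib, Finset.sum_filter]
  refine (norm_sum_le _ _).trans (Finset.sum_le_sum fun I _ ↦ ?_)
  rw [← sub_mul, norm_mul, Complex.norm_real, Real.norm_of_nonneg (idealVonMangoldt_nonneg I)]
  have h1 : ∀ J : Ideal (𝓞 K), idealPow K (fun _ ↦ (1 : ℂ)) J = 1 := fun J ↦ by
    unfold idealPow; exact finprod_eq_one_of_forall_eq_one fun v ↦ one_pow _
  by_cases hI0 : I = ⊥
  · subst hI0
    rw [idealVonMangoldt_bot, mul_zero]
    split_ifs <;> simp
  by_cases hcop : IsCoprime I 𝔪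
  · rw [if_neg (not_not.2 hcop)]
    have heq : classGroupCharIdealHom (1 : ClassGroup (𝓞 K) →* ℂˣ) I = rayClassCoeff 𝔪 (fun _ ↦ (1 : ℂ)) I := by
      rw [classGroupCharIdealHom_apply_of_ne_bot _ hI0, MonoidHom.one_apply, Units.val_one]
      unfold rayClassCoeff; rw [if_pos ⟨hI0, hcop⟩, h1]
    rw [heq, sub_self, norm_zero, zero_mul]
  · rw [if_pos hcop]
    have hb : rayClassCoeff 𝔪 (fun _ ↦ (1 : ℂ)) I = 0 := by
      unfold rayClassCoeff; rw [if_neg (fun h ↦ hcop h.2)]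
    rw [hb, sub_zero, classGroupCharIdealHom_apply_of_ne_bot _ hI0, MonoidHom.one_apply, Units.val_one, norm_one,
      one_mul]

/-! ### The smoothed sums -/

/-- **Generic comparison of two smoothed coefficient sums**: if `‖a(n) − b(n)‖ ≤ d(n)`, `|g| ≤ 1` and `g = 0` on
`[X, ∞)` with `X ≤ log N` (`N ≥ 1`), then `‖K_{g,a}(0) − K_{g,b}(0)‖ ≤ Σ_{n<N} d(n)`. [folklore] -/
private theorem norm_coefFordK_sub_coefFordK_le {a b : ℕ → ℂ} {d : ℕ → ℝ} (hab : ∀ n, ‖a n - b n‖ ≤ d n)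
    {g : ℝ → ℝ} (hg1 : ∀ u, |g u| ≤ 1) {X : ℝ} (hg0 : ∀ u, X ≤ u → g u = 0) {N : ℕ} (hN : 1 ≤ N)
    (hX : X ≤ Real.log N) :
    ‖coefFordK a g 0 - coefFordK b g 0‖ ≤ ∑ n ∈ Finset.range N, d n := by
  rw [coefFordK_eq_sum a hg0 hN hX, coefFordK_eq_sum b hg0 hN hX, ← Finset.sum_sub_distrib]
  refine (norm_sum_le _ _).trans (Finset.sum_le_sum fun n _ ↦ ?_)
  rw [← sub_mul, ← sub_mul, neg_zero, Complex.cpow_zero, mul_one, norm_mul, Complex.norm_real,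
    Real.norm_eq_abs]
  have hd : 0 ≤ d n := le_trans (norm_nonneg _) (hab n)
  calc ‖a n - b n‖ * |g (Real.log n)| ≤ d n * 1 := mul_le_mul (hab n) (hg1 _) (abs_nonneg _) hd
    _ = d n := mul_one _

/-- **The smoothed sums against the Thorner–Zaman weight**: if `‖a(n) − b(n)‖ ≤ Σ_{N𝔫 = n, (𝔫,𝔪)≠1} Λ(𝔫)`
for all `n`, then for `g = tzTest L ε` (`L > 0`, `0 < ε ≤ 1`):
`‖K_{g,a}(0) − K_{g,b}(0)‖ ≤ 2 (L + 2) log N𝔪`. [cite: ThornerZaman2017, Lemma 9.3] -/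
theorem norm_coefFordK_sub_le_of_tzTest (h𝔪 : 𝔪 ≠ ⊥) {a b : ℕ → ℂ}
    (hab : ∀ n, ‖a n - b n‖ ≤ ∑ I ∈ (idealsOfNorm K n).filter (fun I ↦ ¬ IsCoprime I 𝔪), idealVonMangoldt I)
    {L ε : ℝ} (hL : 0 < L) (hε : 0 < ε) (hε1 : ε ≤ 1) :
    ‖coefFordK a (tzTest L ε) 0 - coefFordK b (tzTest L ε) 0‖ ≤ 2 * (L + 2) * Real.log (Ideal.absNorm 𝔪 : ℕ) := by
  set N : ℕ := ⌊Real.exp (L + ε)⌋₊ + 1 with hN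
  have hN1 : 1 ≤ N := by rw [hN]; omega
  have hE0 : 0 < Real.exp (L + ε) := Real.exp_pos _
  have hNlt : Real.exp (L + ε) < N := by rw [hN]; push_cast; exact Nat.lt_floor_add_one _
  have hN0 : (0 : ℝ) < N := hE0.trans hNlt
  have hXN : L + ε ≤ Real.log N := by
    have := Real.log_lt_log hE0 hNlt
    rw [Real.log_exp] at this; exact this.le
  have hNle : (N : ℝ) ≤ 2 * Real.exp (L + ε) := by
    rw [hN]; push_cast
    have h1 := Nat.floor_le hE0.le
    have h2 : (1 : ℝ) ≤ Real.exp (L + ε) := Real.one_le_exp (by linarith)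
    linarith
  have hlogN : Real.log N ≤ L + 2 := by
    have h1 := Real.log_le_log hN0 hNle
    rw [Real.log_mul (by norm_num) hE0.ne', Real.log_exp] at h1
    have hl2 : Real.log 2 < 1 := by have := Real.log_two_lt_d9; linarith
    linarith
  have hg1 : ∀ u, |tzTest L ε u| ≤ 1 := fun u ↦ by
    have h := tzTest_mem_Icc L ε u
    rw [abs_of_nonneg h.1]; exact h.2
  have hkey := norm_coefFordK_sub_coefFordK_le hab hg1 (fun u hu ↦ tzTest_eq_zero_of_ge hL hε hu) hN1 hXN
  refine hkey.trans ((sum_range_idealVonMangoldt_not_isCoprime_le h𝔪 N).trans ?_)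
  have hlogm : 0 ≤ Real.log (Ideal.absNorm 𝔪 : ℕ) := Real.log_natCast_nonneg _
  have hl2 : (1 : ℝ) / 2 < Real.log 2 := by have := Real.log_two_gt_d9; linarith
  have hdiv : Real.log N / Real.log 2 ≤ 2 * (L + 2) := by
    rw [div_le_iff₀ (by linarith)]
    have : 0 ≤ Real.log (N : ℝ) := Real.log_natCast_nonneg _
    nlinarith
  exact mul_le_mul_of_nonneg_right hdiv hlogm

namespace RayClassPrimitiveData

variable {ψ : HeightOneSpectrum (𝓞 K) → ℂ} (D : RayClassPrimitiveData 𝔪 ψ)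

/-- **Imprimitive versus primitive smoothed prime-power sums**: for `g = tzTest L ε` (`L > 0`, `0 < ε ≤ 1`),
`‖K_{g,Λ^𝔪_ψ}(0) − K_{g,Λ_{χ₀}}(0)‖ ≤ 2 (L + 2) log N𝔪`. [cite: ThornerZaman2017, Lemma 9.3] -/
theorem norm_coefFordK_tzTest_sub_le {L ε : ℝ} (hL : 0 < L) (hε : 0 < ε) (hε1 : ε ≤ 1) :
    ‖coefFordK (rcCoef 𝔪 ψ) (tzTest L ε) 0 - coefFordK (rcCoef D.𝔣 D.χ₀) (tzTest L ε) 0‖ ≤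
      2 * (L + 2) * Real.log (Ideal.absNorm 𝔪 : ℕ) := by
  refine norm_coefFordK_sub_le_of_tzTest D.modulus_ne_bot (fun n ↦ ?_) hL hε hε1
  rw [norm_sub_rev]; exact D.norm_rcCoef_sub_rcCoef_le n

end RayClassPrimitiveData

/-- **The trivial character: smoothed sums `mod 𝔪` versus all ideals**: for `g = tzTest L ε` (`L > 0`,
`0 < ε ≤ 1`) and `𝔪 ≠ 0`, `‖K_{g,Λ^𝔪_1}(0) − K_{g,Λ_K}(0)‖ ≤ 2 (L + 2) log N𝔪`. [cite: ThornerZaman2017, Lemma 9.3] -/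
theorem norm_coefFordK_tzTest_one_sub_le (h𝔪 : 𝔪 ≠ ⊥) {L ε : ℝ} (hL : 0 < L) (hε : 0 < ε) (hε1 : ε ≤ 1) :
    ‖coefFordK (rcCoef 𝔪 (fun _ ↦ (1 : ℂ))) (tzTest L ε) 0 -
        coefFordK (cgCoef (1 : ClassGroup (𝓞 K) →* ℂˣ)) (tzTest L ε) 0‖ ≤
      2 * (L + 2) * Real.log (Ideal.absNorm 𝔪 : ℕ) := by
  refine norm_coefFordK_sub_le_of_tzTest h𝔪 (fun n ↦ ?_) hL hε hε1
  rw [norm_sub_rev]; exact norm_cgCoef_one_sub_rcCoef_le 𝔪 n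

end Literature.NumberTheory.LFunctions

end
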